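import Literature.Computability.Complexity.GaussRankList
import Literature.Computability.MetaComplexity.SmolenskyNaturalProperty
import HarnessLib

/-!
# The Razborov–Smolensky property as a rank test on explicit rows

Continuation of `SmolenskyNaturalProperty.lean` (groundwork for the named fact
`Literature.Computability.Learning.cikk_learn_AC0Mod`, CIKK 2016 Cor. 5.4, via CIKK Thm. 5.3):
the CONSTRUCTIVITY of `rsProperty p` ("the natural property is `NC²`-computable", Razborov–Rudich
1997 §3.2; CIKK Thm. 5.3: Gaussian elimination on the truth table). This file is the mathematical
half: it writes the test `dim_F(gL + L) ≥ (3/4)2ᵐ` as the rank of an explicit list of `2·2ᵐ` row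
vectors read off the truth table — in exactly the list shape a string machine produces — and
proves the two agree; `SmolenskyConstructive.lean` then runs it in polynomial time.

* `pt m k` — the `k`-th point of the cube in truth-table order (`(boolFunEquivFin m).symm k`),
  with `pt_apply : pt m k i = k.testBit i`; `bitsOf m s` (the `m` low bits of `s`, as a halving
  fold: `bitsOf_eq_ofFn`), `popc`, `subsetB` (mask inclusion) and the mask sets `maskSet m s`;
* the rows: `monoEntry m s k = [popc s ≤ m/2 ∧ mask s ⊆ mask k]` (the monomial `x_S` of the
  small set `S = maskSet s` at the point `pt k`, else `0`), `monoRow`, `monos`, and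
  `propRows m gl = monos ++ (monos zipped with the value list gl)` (`g · x_S`);
* **`finrank_ispace_eq_lrank`**: `finrank F (ispace F h) = lrank (2ᵐ) (propRows m (glOf h))` —
  through the linear equivalence `Φ : CubeFn F m ≃ (Fin 2ᵐ → F)` of truth-table order
  (`span_range_rowVec`), zero rows for the large masks being harmless;
  `propTest_eq_true_iff : propTest m (glOf h) = true ↔ h ∈ iproperty F m`;
* the truth-table side: `glOdd`/`glEven` (the value lists read from a string in blocks, for the
  function itself and for its restriction `x₀ := 0` = the even positions, `cons0_pt`), the doubling
  fold `log2Fold` (`log2Fold_eq`), the decision function `rsDecide p : List Bool → Bool`, and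
  **`rsDecide_eq_true_iff : rsDecide p w = true ↔ w ∈ truthTableLanguage (rsProperty p)`**.

All statements are proved.

## References

* A. A. Razborov, S. Rudich, *Natural proofs*, JCSS 55 (1997), §3.2 [RazborovRudich1997].
* M. Carmosino, R. Impagliazzo, V. Kabanets, A. Kolokolova, *Learning algorithms from natural
  proofs*, CCC 2016, Thm. 5.3 [CarmosinoImpagliazzoKabanetsKolokolova2016].
-/

namespace Literature.Computability.MetaComplexity

open Finset Module Literature.Computability.Complexity Literature.Computability.Complexity.GaussRank

namespace Smolensky

variable {F : Type*} [Field F] [DecidableEq F] {m : ℕ}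

/-! ### Points of the cube in truth-table order -/

/-- The `k`-th point of the cube `{0,1}ᵐ` in the order of `truthTable`. [folklore] -/
def pt (m : ℕ) (k : Fin (2 ^ m)) : Fin m → Bool := (boolFunEquivFin m).symm k

/-- **Coordinates of the `k`-th point are the bits of `k`** (least significant bit = variable
`0`). [cite: KabanetsCai2000, §2] -/
theorem pt_apply (k : Fin (2 ^ m)) (i : Fin m) : pt m k i = (k : ℕ).testBit i := by
  rw [Nat.testBit_eq_decide_div_mod_eq]
  simp only [pt, boolFunEquivFin, Equiv.symm_trans_apply, Equiv.arrowCongr_symm, Equiv.symm_symm,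
    Equiv.arrowCongr_apply, Equiv.coe_refl, Function.comp_apply, id_eq]
  have hv := finFunctionFinEquiv_symm_apply_val k i
  generalize finFunctionFinEquiv.symm k i = d at hv
  revert hv
  refine Fin.cases ?_ (fun j => ?_) d
  · intro hv; simp at hv; simp [finTwoEquiv]; omega
  · intro hv
    have hj : j = 0 := Subsingleton.elim _ _
    subst hj
    simp at hv; simp [finTwoEquiv]; omega

/-- The point with given Boolean coordinates has the expected index: bits of
`boolFunEquivFin m b` are the coordinates of `b`. [folklore] -/
theorem testBit_boolFunEquivFin (b : Fin m → Bool) (i : Fin m) :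
    ((boolFunEquivFin m b : Fin (2 ^ m)) : ℕ).testBit i = b i := by
  rw [← pt_apply, pt, Equiv.symm_apply_apply]

/-- The truth table lists the values in the order `pt`. [folklore] -/
theorem getD_truthTable (h : (Fin m → Bool) → Bool) (k : Fin (2 ^ m)) :
    (truthTable h).getD k false = h (pt m k) := by
  unfold truthTable
  rw [List.getD_eq_getElem _ _ (by simp), List.getElem_ofFn]
  rfl

/-! ### Bit lists, masks, inclusion -/

/-- The halving step: emit the low bit, halve. [folklore] -/
def halfStep (st : ℕ × List Bool) (_u : Unit) : ℕ × List Bool :=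
  (st.1 / 2, st.2 ++ [decide (st.1 % 2 = 1)])

/-- **The `m` low bits of `s`** (least significant first), as a halving fold over a budget of
`m` units. [folklore] -/
def bitsOf (m s : ℕ) : List Bool := ((List.replicate m ()).foldl halfStep (s, [])).2

/-- Semantics of the halving fold. [folklore] -/
theorem foldl_halfStep (t s : ℕ) (acc : List Bool) :
    (List.replicate t ()).foldl halfStep (s, acc) =
      (s / 2 ^ t, acc ++ List.ofFn fun i : Fin t => s.testBit i) := by
  induction t generalizing s acc with
  | zero => simp
  | succ t ih =>
    rw [List.replicate_succ, List.foldl_cons, show halfStep (s, acc) () = (s / 2, acc ++ [decide (s % 2 = 1)])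
      from rfl, ih, List.ofFn_succ, List.append_assoc, List.singleton_append, Nat.div_div_eq_div_mul,
      ← pow_succ']
    simp only [Fin.val_zero, Fin.val_succ, Nat.testBit_zero, Nat.testBit_add_one]

/-- `bitsOf m s` lists `s.testBit 0, …, s.testBit (m-1)`. [folklore] -/
theorem bitsOf_eq_ofFn (m s : ℕ) : bitsOf m s = List.ofFn fun i : Fin m => s.testBit i := by
  rw [bitsOf, foldl_halfStep, List.nil_append]

/-- `bitsOf` has length `m`. [folklore] -/
@[simp] theorem length_bitsOf (m s : ℕ) : (bitsOf m s).length = m := by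
  rw [bitsOf_eq_ofFn, List.length_ofFn]

/-- Reading a bit. [folklore] -/
theorem getD_bitsOf (m s : ℕ) (i : Fin m) : (bitsOf m s).getD i false = s.testBit i := by
  rw [bitsOf_eq_ofFn, List.getD_eq_getElem _ _ (by simp), List.getElem_ofFn]

/-- The number of ones among the `m` low bits. [folklore] -/
def popc (m s : ℕ) : ℕ := (bitsOf m s).countP id

/-- Mask inclusion on the `m` low bits: every bit of `s` is a bit of `k`. [folklore] -/
def subsetB (m s k : ℕ) : Bool := (List.zipWith (fun a b => !a || b) (bitsOf m s) (bitsOf m k)).all id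

/-- The set of positions `< m` where `s` has a one. [folklore] -/
def maskSet (m s : ℕ) : Finset (Fin m) := univ.filter fun i => s.testBit i

/-- `popc` counts the mask set. [folklore] -/
theorem card_maskSet (m s : ℕ) : (maskSet m s).card = popc m s := by
  rw [popc, countP_eq_card_filter id false (bitsOf m s) m (length_bitsOf m s), maskSet]
  refine congrArg Finset.card (Finset.filter_congr fun i _ => ?_)
  rw [id, getD_bitsOf]

/-- Semantics of mask inclusion. [folklore] -/
theorem subsetB_eq_true_iff (m s k : ℕ) :
    subsetB m s k = true ↔ ∀ i : Fin m, s.testBit i = true → k.testBit i = true := by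
  have hz : List.zipWith (fun a b => !a || b) (bitsOf m s) (bitsOf m k) =
      List.ofFn fun i : Fin m => (!s.testBit i || k.testBit i) := by
    apply List.ext_getElem
    · simp
    · intro i h1 h2
      rw [List.getElem_zipWith, List.getElem_ofFn]
      simp only [bitsOf_eq_ofFn, List.getElem_ofFn]
  rw [subsetB, hz, List.all_eq_true]
  constructor
  · intro h i hi
    have := h _ (List.mem_ofFn.2 ⟨i, rfl⟩)
    simpa [hi] using this
  · intro h x hx
    obtain ⟨i, rfl⟩ := List.mem_ofFn.1 hx
    cases hs : s.testBit i
    · simp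
    · simpa using h i hs

/-- Mask inclusion is inclusion of mask sets. [folklore] -/
theorem subsetB_eq_true_iff_subset (m s k : ℕ) : subsetB m s k = true ↔ maskSet m s ⊆ maskSet m k := by
  rw [subsetB_eq_true_iff]
  simp [maskSet, Finset.subset_iff]

/-- The mask set of the index of an indicator vector is the set. [folklore] -/
theorem maskSet_boolFunEquivFin (T : Finset (Fin m)) :
    maskSet m (boolFunEquivFin m (fun i => decide (i ∈ T)) : Fin (2 ^ m)) = T := by
  ext i
  rw [maskSet, Finset.mem_filter, testBit_boolFunEquivFin]
  simp

omit [DecidableEq F] in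
/-- **A monomial at a point of the cube, in masks**: `x_{mask s}(pt k) = [mask s ⊆ mask k]`.
[folklore] -/
theorem mono_maskSet_pt (s : ℕ) (k : Fin (2 ^ m)) :
    mono F (maskSet m s) (pt m k) = if subsetB m s k then 1 else 0 := by
  rw [mono_apply]
  have : (∀ i ∈ maskSet m s, pt m k i = true) ↔ subsetB m s k = true := by
    rw [subsetB_eq_true_iff]
    simp [maskSet, pt_apply]
  by_cases h : subsetB m s k = true
  · rw [if_pos (this.2 h), if_pos h]
  · rw [if_neg (fun h' => h (this.1 h')), if_neg h]

/-! ### The rows -/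

/-- The entry of the monomial row of mask `s` at column `k`: `x_S(pt k)` for the small set
`S = mask s` (`|S| ≤ m/2`), and `0` for large masks. [folklore] -/
def monoEntry (F : Type*) [Field F] (m s k : ℕ) : F :=
  if decide (popc m s ≤ m / 2) && subsetB m s k then 1 else 0

/-- The monomial row of mask `s` (columns `k < 2ᵐ`). [folklore] -/
def monoRow (F : Type*) [Field F] (m s : ℕ) : List F := (List.range (2 ^ m)).map (monoEntry F m s)

/-- All monomial rows, masks `s < 2ᵐ`. [folklore] -/
def monos (F : Type*) [Field F] (m : ℕ) : List (List F) := (List.range (2 ^ m)).map (monoRow F m)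

/-- **The rows of the property test**: the monomial rows `x_S` and the rows `g · x_S`, for the
value list `gl` of `g` in truth-table order. [cite: CarmosinoImpagliazzoKabanetsKolokolova2016, Thm. 5.3 (§5.2: the space f̄L + L)] -/
def propRows (m : ℕ) (gl : List F) : List (List F) :=
  monos F m ++ (monos F m).map fun mr => List.zipWith (· * ·) gl mr

/-- **The property test on a value list**: `3·2ᵐ ≤ 4 · rank`. [cite: CarmosinoImpagliazzoKabanetsKolokolova2016, Thm. 5.3] -/
def propTest (m : ℕ) (gl : List F) : Bool :=
  decide (3 * 2 ^ m ≤ 4 * lrank (2 ^ m) (propRows m gl))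

/-- The value list of a Boolean function in truth-table order, as `0/1 ∈ F`. [folklore] -/
def glOf (F : Type*) [Field F] (h : (Fin m → Bool) → Bool) : List F :=
  (List.range (2 ^ m)).map fun k => if h (fun i => k.testBit i) then 1 else 0

omit [DecidableEq F] in
/-- Length of a monomial row. [folklore] -/
@[simp] theorem length_monoRow (s : ℕ) : (monoRow F m s).length = 2 ^ m := by
  simp [monoRow]

omit [DecidableEq F] in
/-- Number of monomial rows. [folklore] -/
@[simp] theorem length_monos : (monos F m).length = 2 ^ m := by
  simp [monos]

omit [DecidableEq F] in
/-- Length of the value list. [folklore] -/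
@[simp] theorem length_glOf (h : (Fin m → Bool) → Bool) : (glOf F h).length = 2 ^ m := by
  simp [glOf]

omit [DecidableEq F] in
/-- Number of rows. [folklore] -/
theorem length_propRows (gl : List F) : (propRows m gl).length = 2 ^ m + 2 ^ m := by
  simp [propRows]

omit [DecidableEq F] in
/-- Every row has length `2ᵐ` when the value list does. [folklore] -/
theorem length_of_mem_propRows {gl : List F} (hgl : gl.length = 2 ^ m) :
    ∀ r ∈ propRows m gl, r.length = 2 ^ m := by
  intro r hr
  rw [propRows, List.mem_append] at hr
  rcases hr with hr | hr
  · rw [monos, List.mem_map] at hr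
    obtain ⟨s, -, rfl⟩ := hr
    exact length_monoRow s
  · rw [List.mem_map] at hr
    obtain ⟨mr, hmr, rfl⟩ := hr
    rw [monos, List.mem_map] at hmr
    obtain ⟨s, -, rfl⟩ := hmr
    rw [List.length_zipWith, hgl, length_monoRow, min_self]

omit [DecidableEq F] in
/-- Reading a monomial row. [folklore] -/
theorem getD_monoRow (s : ℕ) (k : Fin (2 ^ m)) : (monoRow F m s).getD k 0 = monoEntry F m s k := by
  rw [monoRow, List.getD_eq_getElem _ _ (by simp), List.getElem_map, List.getElem_range]

omit [DecidableEq F] in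
/-- Reading the list of monomial rows. [folklore] -/
theorem getD_monos (s : Fin (2 ^ m)) : (monos F m).getD s [] = monoRow F m s := by
  rw [monos, List.getD_eq_getElem _ _ (by simp), List.getElem_map, List.getElem_range]

omit [DecidableEq F] in
/-- Reading the value list. [folklore] -/
theorem getD_glOf (h : (Fin m → Bool) → Bool) (k : Fin (2 ^ m)) :
    (glOf F h).getD k 0 = if h (pt m k) then 1 else 0 := by
  rw [glOf, List.getD_eq_getElem _ _ (by simp), List.getElem_map, List.getElem_range]
  have : (fun i : Fin m => (k : ℕ).testBit i) = pt m k := funext fun i => (pt_apply k i).symm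
  rw [this]

omit [DecidableEq F] in
/-- Reading the first block of rows. [folklore] -/
theorem getD_propRows_left (gl : List F) (s : Fin (2 ^ m)) :
    (propRows m gl).getD s [] = monoRow F m s := by
  rw [propRows, List.getD_append _ _ _ _ (by simp), getD_monos]

omit [DecidableEq F] in
/-- Reading the second block of rows. [folklore] -/
theorem getD_propRows_right (gl : List F) (s : Fin (2 ^ m)) :
    (propRows m gl).getD (2 ^ m + s) [] = List.zipWith (· * ·) gl (monoRow F m s) := by
  rw [propRows, List.getD_append_right _ _ _ _ (by simp), length_monos, Nat.add_sub_cancel_left,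
    show ([] : List F) = (fun mr => List.zipWith (· * ·) gl mr) [] by simp, List.getD_map, getD_monos]

/-! ### The row span is the image of `gL + L` in truth-table coordinates -/

/-- Truth-table coordinates: a function on the cube as the vector of its values at
`pt 0, …, pt (2ᵐ-1)`. [folklore] -/
noncomputable def Φ (F : Type*) [Field F] (m : ℕ) : CubeFn F m ≃ₗ[F] (Fin (2 ^ m) → F) :=
  LinearEquiv.funCongrLeft F F (boolFunEquivFin m).symm

omit [DecidableEq F] in
/-- `Φ u k = u (pt k)`. [folklore] -/
@[simp] theorem Φ_apply (u : CubeFn F m) (k : Fin (2 ^ m)) : Φ F m u k = u (pt m k) := rfl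

omit [DecidableEq F] in
/-- **The monomial row of a small mask is the monomial in truth-table coordinates**; a large mask
gives the zero row. [folklore] -/
theorem monoEntry_eq (s : ℕ) (k : Fin (2 ^ m)) :
    monoEntry F m s k = if popc m s ≤ m / 2 then Φ F m (mono F (maskSet m s)) k else 0 := by
  rw [monoEntry, Φ_apply, mono_maskSet_pt]
  by_cases h : popc m s ≤ m / 2
  · simp [h]
  · simp [h]

/-- The row vectors of the test, as a family indexed by `Fin (2ᵐ + 2ᵐ)`. [folklore] -/
def rowVec (h : (Fin m → Bool) → Bool) : Fin (propRows m (glOf F h)).length → Fin (2 ^ m) → F :=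
  fun i k => ((propRows m (glOf F h)).getD i []).getD k 0

omit [DecidableEq F] in
/-- The rows of the first block. [folklore] -/
theorem rowVec_left (h : (Fin m → Bool) → Bool) (s : Fin (2 ^ m))
    (hs : (s : ℕ) < (propRows m (glOf F h)).length) :
    rowVec h ⟨s, hs⟩ = if popc m s ≤ m / 2 then Φ F m (mono F (maskSet m s)) else 0 := by
  funext k
  rw [rowVec]
  dsimp only
  rw [getD_propRows_left, getD_monoRow, monoEntry_eq]
  split_ifs <;> rfl

omit [DecidableEq F] in
/-- The rows of the second block. [folklore] -/
theorem rowVec_right (h : (Fin m → Bool) → Bool) (s : Fin (2 ^ m))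
    (hs : 2 ^ m + (s : ℕ) < (propRows m (glOf F h)).length) :
    rowVec h ⟨2 ^ m + s, hs⟩ =
      if popc m s ≤ m / 2 then Φ F m (indOf F h * mono F (maskSet m s)) else 0 := by
  funext k
  rw [rowVec]
  dsimp only
  rw [getD_propRows_right, List.getD_eq_getElem _ _ (by simp), List.getElem_zipWith]
  have h1 : (glOf F h)[(k : ℕ)]'(by simp) = (glOf F h).getD k 0 := (List.getD_eq_getElem _ _ _).symm
  have h2 : (monoRow F m s)[(k : ℕ)]'(by simp) = (monoRow F m s).getD k 0 := (List.getD_eq_getElem _ _ _).symm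
  rw [h1, h2, getD_glOf, getD_monoRow, monoEntry_eq]
  by_cases hsm : popc m s ≤ m / 2
  · simp only [if_pos hsm, Φ_apply, Pi.mul_apply, indOf_apply]
  · simp only [if_neg hsm, Pi.zero_apply, mul_zero]

omit [DecidableEq F] in
/-- **The row span is the image of `gL + L`** under the truth-table coordinates. [folklore] -/
theorem span_range_rowVec (h : (Fin m → Bool) → Bool) :
    Submodule.span F (Set.range (rowVec (F := F) h)) = (ispace F h).map (Φ F m).toLinearMap := by
  have hlen : (propRows m (glOf F h)).length = 2 ^ m + 2 ^ m := length_propRows _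
  apply le_antisymm
  · -- every row lies in the image
    rw [Submodule.span_le]
    rintro _ ⟨⟨i, hi⟩, rfl⟩
    rw [SetLike.mem_coe]
    by_cases hlt : i < 2 ^ m
    · rw [rowVec_left h ⟨i, hlt⟩ hi]
      split_ifs with hsm
      · refine Submodule.mem_map_of_mem ?_
        unfold ispace
        refine Submodule.mem_sup_right (mono_mem_lowDeg ?_)
        rwa [card_maskSet]
      · exact Submodule.zero_mem _
    · obtain ⟨s, rfl⟩ : ∃ s, i = 2 ^ m + s := ⟨i - 2 ^ m, by omega⟩
      have hs : s < 2 ^ m := by omega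
      rw [rowVec_right h ⟨s, hs⟩ hi]
      split_ifs with hsm
      · refine Submodule.mem_map_of_mem ?_
        unfold ispace
        refine Submodule.mem_sup_left (Submodule.mem_map_of_mem (f := LinearMap.mulLeft F (indOf F h)) ?_)
        refine mono_mem_lowDeg ?_
        rwa [card_maskSet]
      · exact Submodule.zero_mem _
  · -- the generators of `gL + L` are rows
    rw [Submodule.map_le_iff_le_comap]
    have hgen : ∀ T : Finset (Fin m), T.card ≤ m / 2 →
        Φ F m (mono F T) ∈ Submodule.span F (Set.range (rowVec (F := F) h)) ∧
          Φ F m (indOf F h * mono F T) ∈ Submodule.span F (Set.range (rowVec (F := F) h)) := by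
      intro T hT
      set s : Fin (2 ^ m) := boolFunEquivFin m (fun i => decide (i ∈ T)) with hsdef
      have hmask : maskSet m s = T := maskSet_boolFunEquivFin T
      have hsm : popc m s ≤ m / 2 := by rwa [← card_maskSet, hmask]
      constructor
      · have hrow := rowVec_left h s (by rw [hlen]; omega)
        rw [if_pos hsm, hmask] at hrow
        rw [← hrow]
        exact Submodule.subset_span ⟨_, rfl⟩
      · have hrow := rowVec_right h s (by rw [hlen]; omega)
        rw [if_pos hsm, hmask] at hrow
        rw [← hrow]
        exact Submodule.subset_span ⟨_, rfl⟩
    unfold ispace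
    refine sup_le ?_ ?_
    · rw [Submodule.map_le_iff_le_comap, lowDeg_eq_span, Submodule.span_le]
      rintro _ ⟨⟨T, hT⟩, rfl⟩
      exact (hgen T hT).2
    · rw [lowDeg_eq_span, Submodule.span_le]
      rintro _ ⟨⟨T, hT⟩, rfl⟩
      exact (hgen T hT).1

/-- **The dimension of `gL + L` is the list rank of the explicit rows.** [cite: CarmosinoImpagliazzoKabanetsKolokolova2016, Thm. 5.3 (NC²-constructivity)] -/
theorem finrank_ispace_eq_lrank (h : (Fin m → Bool) → Bool) :
    Module.finrank F (ispace F h) = lrank (2 ^ m) (propRows m (glOf F h)) := by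
  rw [lrank_eq_finrank_span _ (length_of_mem_propRows (length_glOf h))]
  change _ = Module.finrank F (Submodule.span F (Set.range (rowVec (F := F) h)))
  rw [span_range_rowVec, LinearEquiv.finrank_map_eq]

/-- **The property test decides the `0/1` property.** [cite: CarmosinoImpagliazzoKabanetsKolokolova2016, Thm. 5.3] -/
theorem propTest_eq_true_iff (h : (Fin m → Bool) → Bool) :
    propTest m (glOf F h) = true ↔ h ∈ iproperty F m := by
  rw [propTest, ← finrank_ispace_eq_lrank, decide_eq_true_iff, mem_iproperty_iff]

/-! ### Reading the value lists off a truth table -/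

/-- A block of at most one bit, as `0/1`. [folklore] -/
def bitOfBlock (F : Type*) [Field F] (blk : List Bool) : F := if blk.headD false then 1 else 0

/-- The value list of the function with truth table `w` (blocks of length `1`). [folklore] -/
def glOdd (F : Type*) [Field F] (m : ℕ) (w : List Bool) : List F :=
  (List.range (2 ^ m)).map fun k => bitOfBlock F ((w.drop (k * 1)).take 1)

/-- The value list of the restriction `x₀ := 0` of the function with truth table `w` (the first
bit of each block of length `2`: the even positions). [folklore] -/
def glEven (F : Type*) [Field F] (m : ℕ) (w : List Bool) : List F :=
  (List.range (2 ^ m)).map fun k => bitOfBlock F (((w.drop (k * 2)).take 2).take 1)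

omit [DecidableEq F] in
/-- A one-bit block read at position `k`. [folklore] -/
theorem bitOfBlock_take_one (w : List Bool) (k : ℕ) :
    bitOfBlock F ((w.drop k).take 1) = if w.getD k false then 1 else 0 := by
  rw [bitOfBlock]
  congr 1
  rw [List.getD_eq_getElem?_getD, ← List.head?_drop]
  cases w.drop k <;> simp

omit [DecidableEq F] in
/-- **The value list of a truth table is `glOf`.** [folklore] -/
theorem glOdd_truthTable (h : (Fin m → Bool) → Bool) : glOdd F m (truthTable h) = glOf F h := by
  rw [glOdd, glOf]
  refine List.map_congr_left fun k hk => ?_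
  rw [List.mem_range] at hk
  rw [Nat.mul_one, bitOfBlock_take_one, getD_truthTable h ⟨k, hk⟩]
  have : pt m ⟨k, hk⟩ = fun i : Fin m => k.testBit i := funext fun i => pt_apply _ i
  rw [this]

/-- **Prepending a zero doubles the index**: `cons0 (pt m k) = pt (m+1) (2k)`. [folklore] -/
theorem cons0_pt (k : Fin (2 ^ m)) :
    cons0 (pt m k) = pt (m + 1) ⟨2 * k, by have := k.isLt; rw [pow_succ]; omega⟩ := by
  funext i
  rw [pt_apply]
  refine Fin.cases ?_ (fun j => ?_) i
  · rw [cons0_zero, Fin.val_zero, Nat.testBit_zero]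
    simp
  · rw [cons0_succ, pt_apply, Fin.val_succ, Nat.testBit_succ]
    simp

omit [DecidableEq F] in
/-- **The even positions of a truth table are the value list of the restriction `x₀ := 0`.**
[folklore] -/
theorem glEven_truthTable (h : (Fin (m + 1) → Bool) → Bool) :
    glEven F m (truthTable h) = glOf F (restrictFirst h) := by
  rw [glEven, glOf]
  refine List.map_congr_left fun k hk => ?_
  rw [List.mem_range] at hk
  rw [List.take_take, show min 1 2 = 1 from rfl, bitOfBlock_take_one]
  have h2k : k * 2 < 2 ^ (m + 1) := by rw [pow_succ]; omega
  rw [getD_truthTable h ⟨k * 2, h2k⟩]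
  have hpt : pt (m + 1) ⟨k * 2, h2k⟩ = cons0 (pt m ⟨k, hk⟩) := by
    rw [cons0_pt]; congr 1; apply Fin.ext; simp [mul_comm]
  have : pt m ⟨k, hk⟩ = fun i : Fin m => k.testBit i := funext fun i => pt_apply _ i
  rw [hpt, ← this]
  rfl

/-! ### The decision procedure -/

/-- The doubling fold: `(pw, n)` with `pw = 2ⁿ` the largest power of two `≤ L` (from `(1, 0)`).
[folklore] -/
def log2Step (L : ℕ) (st : ℕ × ℕ) (_u : Unit) : ℕ × ℕ :=
  if st.1 * 2 ≤ L then (st.1 * 2, st.2 + 1) else st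

/-- `log2Fold L = (2^⌊log₂ L⌋, ⌊log₂ L⌋)` for `L ≥ 1` (and `(1, 0)` for `L = 0`), as a fold over a
budget of `L` units. [folklore] -/
def log2Fold (L : ℕ) : ℕ × ℕ := (List.replicate L ()).foldl (log2Step L) (1, 0)

/-- The doubling fold run for `t` steps from `(2^e, e)`: it reaches `min`-capped exponents.
[folklore] -/
theorem foldl_log2Step (L : ℕ) (hL : 1 ≤ L) : ∀ (t e : ℕ), 2 ^ e ≤ L →
    (List.replicate t ()).foldl (log2Step L) (2 ^ e, e) =
      (2 ^ min (e + t) (Nat.log 2 L), min (e + t) (Nat.log 2 L))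
  | 0, e, he => by
    have : min e (Nat.log 2 L) = e := min_eq_left (Nat.le_log_of_pow_le one_lt_two he)
    simp [this]
  | t + 1, e, he => by
    rw [List.replicate_succ, List.foldl_cons]
    by_cases hnext : 2 ^ e * 2 ≤ L
    · rw [show log2Step L (2 ^ e, e) () = (2 ^ (e + 1), e + 1) by
        rw [log2Step, if_pos hnext, pow_succ], foldl_log2Step L hL t (e + 1) (by rwa [pow_succ])]
      congr 2 <;> omega
    · rw [show log2Step L (2 ^ e, e) () = (2 ^ e, e) by rw [log2Step, if_neg hnext],
        foldl_log2Step L hL t e he]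
      have h1 : e ≤ Nat.log 2 L := Nat.le_log_of_pow_le one_lt_two he
      have h2 : Nat.log 2 L < e + 1 := by
        by_contra hc
        have := Nat.pow_le_of_le_log (by omega) (not_lt.1 hc)
        rw [pow_succ] at this
        exact hnext this
      have hm : min (e + t) (Nat.log 2 L) = e := by omega
      have hm' : min (e + (t + 1)) (Nat.log 2 L) = e := by omega
      rw [hm, hm']

/-- **Semantics of the doubling fold**: for `L ≥ 1`, `log2Fold L = (2^⌊log₂ L⌋, ⌊log₂ L⌋)`.
[folklore] -/
theorem log2Fold_eq {L : ℕ} (hL : 1 ≤ L) : log2Fold L = (2 ^ Nat.log 2 L, Nat.log 2 L) := by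
  have h := foldl_log2Step L hL L 0 (by simpa using hL)
  rw [pow_zero, Nat.zero_add] at h
  rw [log2Fold, h]
  have : Nat.log 2 L ≤ L := (Nat.log_le_self 2 L)
  rw [min_eq_right this]

variable {p : ℕ} [Fact p.Prime]

/-- **The decision procedure of the Razborov–Smolensky property on truth tables** (the shape a
string machine runs: length, doubling fold, parity, block reads, rows, list rank, comparison).
[cite: CarmosinoImpagliazzoKabanetsKolokolova2016, Thm. 5.3 (constructivity)] -/
def rsDecide (p : ℕ) [Fact p.Prime] (w : List Bool) : Bool :=
  if (log2Fold w.length).1 = w.length then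
    if (log2Fold w.length).2 = 0 then true
    else if (log2Fold w.length).2 % 2 = 1 then
      propTest (log2Fold w.length).2 (glOdd (ZMod p) (log2Fold w.length).2 w)
    else propTest ((log2Fold w.length).2 - 1) (glEven (ZMod p) ((log2Fold w.length).2 - 1) w)
  else false

/-- A length is a power of two iff the doubling fold returns it. [folklore] -/
theorem log2Fold_fst_eq_iff (L : ℕ) : (log2Fold L).1 = L ↔ ∃ n, L = 2 ^ n := by
  rcases Nat.eq_zero_or_pos L with rfl | hL
  · simp [log2Fold]
    intro n
    positivity
  · rw [log2Fold_eq hL]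
    constructor
    · intro h; exact ⟨_, h.symm⟩
    · rintro ⟨n, rfl⟩; rw [Nat.log_pow one_lt_two]

/-- **Correctness of the decision procedure.** [cite: CarmosinoImpagliazzoKabanetsKolokolova2016, Thm. 5.3] -/
theorem rsDecide_eq_true_iff (w : List Bool) :
    rsDecide p w = true ↔ w ∈ truthTableLanguage (rsProperty p) := by
  rw [rsDecide]
  by_cases hpow : (log2Fold w.length).1 = w.length
  · rw [if_pos hpow]
    obtain ⟨n, hn⟩ := (log2Fold_fst_eq_iff _).1 hpow
    have hL : 1 ≤ w.length := by rw [hn]; exact Nat.one_le_two_pow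
    have hlog : (log2Fold w.length).2 = n := by rw [log2Fold_eq hL, hn, Nat.log_pow one_lt_two]
    rw [hlog]
    -- `w` is the truth table of `f`
    set f : (Fin n → Bool) → Bool := ofTruthTable w hn with hf
    have hw : w = truthTable f := (truthTable_ofTruthTable w hn).symm
    have hmem : w ∈ truthTableLanguage (rsProperty p) ↔ f ∈ rsProperty p n := by
      rw [hw, truthTable_mem_truthTableLanguage_iff]
    by_cases hn0 : n = 0
    · rw [if_pos hn0, hmem]
      subst hn0
      simp only [true_iff]
      exact Set.mem_univ f
    · rw [if_neg hn0]
      by_cases hodd : n % 2 = 1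
      · have hodd' : Odd n := Nat.odd_iff.2 hodd
        rw [if_pos hodd, hw, glOdd_truthTable, propTest_eq_true_iff, ← hw, hmem, rsProperty_of_odd p hodd']
      · rw [if_neg hodd]
        obtain ⟨m, rfl⟩ : ∃ m, n = m + 1 := ⟨n - 1, by omega⟩
        have hm : Odd m := Nat.odd_iff.2 (by omega)
        rw [Nat.add_sub_cancel, hw, glEven_truthTable, propTest_eq_true_iff, ← hw, hmem,
          rsProperty_succ_of_odd p hm]
        rfl
  · rw [if_neg hpow, mem_truthTableLanguage_iff]
    simp only [Bool.false_eq_true, false_iff]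
    rintro ⟨n, hlen, -⟩
    exact hpow ((log2Fold_fst_eq_iff _).2 ⟨n, hlen⟩)

/-- The language of the property is the set of accepted strings. [folklore] -/
theorem truthTableLanguage_rsProperty_eq :
    truthTableLanguage (rsProperty p) = {w | rsDecide p w = true} :=
  Set.ext fun w => (rsDecide_eq_true_iff w).symm

end Smolensky

end Literature.Computability.MetaComplexity
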